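import Mathlib

/-!
# Crux `HilbertIntegralOverconvergentIsCongruence` (stmt-Langlands-8485), line `Sketch-ideate-r1-k1`
# — stub S13a: a `ℚ`-basis of totally positive algebraic integers

Hilbert modular `q`-expansions over a totally real field `F` of degree `d` are re-indexed by `ℕ^d`
via `ν ↦ (Tr(β_j ν))_j`; for this one wants a `ℚ`-basis `β` of `F` consisting of TOTALLY POSITIVE
algebraic INTEGERS.  This file proves its existence:

* `stub_exists_totallyPositive_integralBasis` (registered stub S13a) — a totally real number field
  `F` has a family `β : Fin (finrank ℚ F) → 𝓞 F`, `ℚ`-linearly independent in `F`, with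
  `0 < τ (β j)` for every real embedding `τ`.

Proof: reindex Mathlib's integral basis `NumberField.integralBasis F` by `Fin d` and call the
integer vectors `x j`.  The finitely many real numbers `|τ (x j)|` (`F →+* ℝ` is a `Fintype`) are
bounded by some `B`; pick a natural number `M > max (B, |R⁻¹|)` where `R = Σ_j r_j` is the sum of
the coordinates of `1 = Σ_j r_j x_j`, and put `β j := x j + M`.  Then `τ (β j) = τ (x j) + M > 0`,
and the shifted family is still linearly independent: its matrix in the basis `x` is
`I + M r 𝟙ᵀ`, of determinant `1 + M R ≠ 0` (`tpBasis_linearIndependent_basis_add_smul`, done by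
comparing coordinates rather than determinants).

Theorems only, no `sorry`.
-/

set_option linter.dupNamespace false

namespace Summit.Langlands.Langlands.Theorems.HilbertIntegralOverconvergentIsCongruence

open scoped NumberField
open NumberField

/-- Shifting every vector of a basis `b` by the same vector `c • v` keeps the family linearly
independent as soon as `1 + c · Σ_i (b.repr v)_i ≠ 0` (the determinant of the shifted family in the
basis `b`). [folklore] -/
theorem tpBasis_linearIndependent_basis_add_smul {K V ι : Type*} [Field K] [AddCommGroup V]
    [Module K V] [Fintype ι] (b : Module.Basis ι K V) (v : V) (c : K)
    (hc : 1 + c * ∑ i, b.repr v i ≠ 0) :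
    LinearIndependent K (fun i => b i + c • v) := by
  rw [Fintype.linearIndependent_iff]
  intro g hg
  -- `Σ g_i b_i = -(S c) • v` with `S = Σ g_i`
  have hsum : ∑ i, g i • b i = (-((∑ i, g i) * c)) • v := by
    have h1 : ∑ i, g i • (b i + c • v) = ∑ i, g i • b i + ((∑ i, g i) * c) • v := by
      rw [Finset.sum_mul, Finset.sum_smul, ← Finset.sum_add_distrib]
      refine Finset.sum_congr rfl fun i _ => ?_
      rw [smul_add, smul_smul]
    rw [h1] at hg
    rw [neg_smul]
    exact eq_neg_of_add_eq_zero_left hg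
  -- compare coordinates in the basis `b`
  have hcoord : ∀ i, g i = -((∑ j, g j) * c) * b.repr v i := by
    intro i
    have h1 : b.repr (∑ j, g j • b j) i = b.repr ((-((∑ j, g j) * c)) • v) i := by rw [hsum]
    rwa [b.repr_sum_self, map_smul, Finsupp.smul_apply, smul_eq_mul] at h1
  -- sum over `i`: `S (1 + c R) = 0`, hence `S = 0`
  have hS : (∑ i, g i) * (1 + c * ∑ i, b.repr v i) = 0 := by
    have h1 : ∑ i, g i = ∑ i, -((∑ j, g j) * c) * b.repr v i :=
      Finset.sum_congr rfl fun i _ => hcoord i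
    rw [← Finset.mul_sum] at h1
    linear_combination h1
  have hS0 : ∑ i, g i = 0 := (mul_eq_zero.mp hS).resolve_right hc
  intro i
  rw [hcoord i, hS0]
  ring

/-- **stub S13a — `stub_exists_totallyPositive_integralBasis` (S/M).**  A totally real number field `F` has
a `ℚ`-basis consisting of TOTALLY POSITIVE algebraic integers (shift the integral basis
`NumberField.integralBasis F` by a large natural number `M`: `e_j + M` is totally positive for `M > max |τ e_j|`,
and the shifted family is still linearly independent for all but at most one `M`). [folklore] -/
theorem stub_exists_totallyPositive_integralBasis (F : Type*) [Field F] [NumberField F]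
    [NumberField.IsTotallyReal F] :
    ∃ β : Fin (Module.finrank ℚ F) → 𝓞 F, LinearIndependent ℚ (fun j ↦ (β j : F)) ∧
      ∀ j (τ : F →+* ℝ), 0 < τ (β j) := by
  classical
  -- an integral basis indexed by `Fin d`: a `ℚ`-basis `b` of `F` with integer vectors `x j`
  obtain ⟨b, x, hxb⟩ : ∃ (b : Module.Basis (Fin (Module.finrank ℚ F)) ℚ F)
      (x : Fin (Module.finrank ℚ F) → 𝓞 F), ∀ j, (x j : F) = b j := by
    have e : Module.Free.ChooseBasisIndex ℤ (𝓞 F) ≃ Fin (Module.finrank ℚ F) :=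
      Fintype.equivFinOfCardEq (Module.finrank_eq_card_basis (integralBasis F)).symm
    refine ⟨(integralBasis F).reindex e, fun j => RingOfIntegers.basis F (e.symm j), fun j => ?_⟩
    show algebraMap (𝓞 F) F (RingOfIntegers.basis F (e.symm j)) = _
    rw [Module.Basis.reindex_apply, integralBasis_apply]
  -- a uniform bound for the real embeddings of the `x j`
  obtain ⟨B, hle⟩ : ∃ B : ℝ, ∀ j (τ : F →+* ℝ), |τ (x j : F)| ≤ B := by
    refine ⟨∑ j, ∑ τ : F →+* ℝ, |τ (x j : F)|, fun j τ => ?_⟩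
    calc |τ (x j : F)| ≤ ∑ τ' : F →+* ℝ, |τ' (x j : F)| :=
          Finset.single_le_sum (f := fun τ' : F →+* ℝ => |τ' (x j : F)|)
            (fun _ _ => abs_nonneg _) (Finset.mem_univ τ)
      _ ≤ ∑ j', ∑ τ' : F →+* ℝ, |τ' (x j' : F)| :=
          Finset.single_le_sum (f := fun j' => ∑ τ' : F →+* ℝ, |τ' (x j' : F)|)
            (fun _ _ => Finset.sum_nonneg fun _ _ => abs_nonneg _) (Finset.mem_univ j)
  -- the sum `R` of the coordinates of `1`, and a natural number `M > max (B, |R⁻¹|)`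
  obtain ⟨M, hM⟩ := exists_nat_gt (max B ((|(∑ j, b.repr 1 j)⁻¹| : ℚ) : ℝ))
  have hBM : B < M := (le_max_left _ _).trans_lt hM
  have hRM : |(∑ j, b.repr 1 j)⁻¹| < (M : ℚ) := by
    exact_mod_cast (le_max_right _ _).trans_lt hM
  have hc : 1 + (M : ℚ) * ∑ j, b.repr 1 j ≠ 0 := by
    intro h
    have hinv : (∑ j, b.repr 1 j)⁻¹ = -(M : ℚ) :=
      inv_eq_of_mul_eq_one_left (by linear_combination -h)
    rw [hinv, abs_neg, Nat.abs_cast] at hRM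
    exact lt_irrefl _ hRM
  refine ⟨fun j => x j + (M : 𝓞 F), ?_, ?_⟩
  · -- linear independence of the shifted family `b j + M • 1`
    show LinearIndependent ℚ (fun j => ((x j + (M : 𝓞 F) : 𝓞 F) : F))
    have hfam : (fun j => ((x j + (M : 𝓞 F) : 𝓞 F) : F)) = fun j => b j + (M : ℚ) • (1 : F) := by
      funext j
      rw [← hxb j, Nat.cast_smul_eq_nsmul, nsmul_eq_mul, mul_one]
      show algebraMap (𝓞 F) F (x j + (M : 𝓞 F)) = algebraMap (𝓞 F) F (x j) + (M : F)
      rw [map_add, map_natCast]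
    rw [hfam]
    exact tpBasis_linearIndependent_basis_add_smul b 1 (M : ℚ) hc
  · -- total positivity: `τ (x j) + M > 0` since `|τ (x j)| ≤ B < M`
    intro j τ
    have h1 : ((x j + (M : 𝓞 F) : 𝓞 F) : F) = (x j : F) + (M : F) := by
      show algebraMap (𝓞 F) F (x j + (M : 𝓞 F)) = algebraMap (𝓞 F) F (x j) + (M : F)
      rw [map_add, map_natCast]
    show 0 < τ ((x j + (M : 𝓞 F) : 𝓞 F) : F)
    rw [h1, map_add, map_natCast]
    have h2 := abs_lt.mp ((hle j τ).trans_lt hBM)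
    linarith [h2.1]

end Summit.Langlands.Langlands.Theorems.HilbertIntegralOverconvergentIsCongruence
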